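import Summits.QuantumFields.YangMills.Theorems.LuscherReductionTwistedTraceScalingBOStiffCentralData
import Summits.QuantumFields.YangMills.Theorems.LuscherReductionTwistedTraceScalingBOCentralTube
import HarnessLib

/-!
# (B-ST) central-fibre data: the profile `cΘ` is FLOORED on its support (input `hΘlo` of `StiffDoor.hfib_of_door` / `hgap_of_door`)
# (lane A of S-BASE, crux `TwistedTraceScaling` stmt-QuantumFields-20203, C4-CORE, the (B-ST) pen; HANDOFF-g21 UPDATE 19:55Z Θ-floor remark, spec_gap_inputs)

The cap-restricted frozen profile is not tapered: on its support (`linkCurry ∘ linkEmbed ∈ Bal` and `‖linkEmbed x‖ ≤ r(β)`, `r ≤ 1/40`) it equals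
`e^{−‖P_Γ y‖²/β^{-2}}·e^{−q_β(y)}` with `q_β = stiffGaussExp(β/2, β) ≤ 49β‖y‖²` (`stiffGaussExp_le_mul_norm_sq`), hence
★★ `cΘ_floor` — `∀ x ∈ cS β, exp(−(r²/β^{-2} + 49β r²)) ≤ cΘ β x` with `r = min(1/40, β^{-1/2} btLog β)`; ★ `cΘ_eq_on_cS` — the explicit formula on the support.
HONEST FRAMING: bookkeeping for a stub of a child of the CONDITIONAL route R2b1; (B-ST) OPEN; C4-CORE OPEN; not infinite volume, not a gap, not Clay.
-/

set_option autoImplicit false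

noncomputable section

open MeasureTheory

namespace Summit.QuantumFields.YangMills.Theorems.FemtoTransferGap.TwoLattice.ConstTube

open Literature.MathematicalPhysics.QuantumFieldTheory Literature.MathematicalPhysics.QuantumLattice TwoLattice.Avg TwoLattice.Stiff TwoLattice.GnChart TwoLattice.Cov

variable {L : ℕ} [NeZero L]

/-- ★ On its support the central profile is the explicit Gaussian: `cΘ β x = exp(−‖P_Γ y‖²/β^{-2})·exp(−q_β y)`, `y = linkEmbed x`, and `‖y‖ ≤ r(β)`. [folklore] -/
theorem cΘ_eq_on_cS (β : ℝ) {x : Edge 3 L → Fin 3 → ℝ} (hx : x ∈ cS L β) :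
    cΘ L β x = Real.exp (-(‖(gaugeModes L).starProjection (linkEmbed L x)‖ ^ 2 / powScale 1 β ^ 2)) * Real.exp (-(stiffGaussExp L (β / 2) β (linkEmbed L x))) ∧
      ‖linkEmbed L x‖ ≤ min (1 / 40) (powScale (1 / 2) β * btLog β) := by
  have hne : cΘ L β x ≠ 0 := hx
  unfold cΘ cΩ at hne ⊢
  set y := linkEmbed L x
  by_cases hcap : y ∈ {y : LinkSpace L | linkCurry y ∈ capBalancedSet L}
  · rw [Set.indicator_of_mem hcap, one_mul] at hne ⊢
    by_cases hball : y ∈ Metric.closedBall (0 : LinkSpace L) (min (1 / 40) (powScale (1 / 2) β * btLog β))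
    · refine ⟨?_, by simpa [Metric.mem_closedBall, dist_zero_right] using hball⟩
      unfold frozenProfile; rw [Set.indicator_of_mem hball, mul_one]
    · exfalso; apply hne; unfold frozenProfile; rw [Set.indicator_of_notMem hball, mul_zero]
  · exfalso; apply hne; rw [Set.indicator_of_notMem hcap, zero_mul]

/-- ★★ **Floor of the central profile on its support**: `exp(−(r²/β^{-2}·… + 49βr²))`-type — precisely
`Real.exp (-(r² / powScale 1 β ^ 2 + (96 (β/2) + β) r²)) ≤ cΘ β x` for `x ∈ cS β`, `r = min (1/40) (β^{-1/2} btLog β)`, `β ≥ 0`. [folklore] -/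
theorem cΘ_floor {β : ℝ} (hβ : 0 ≤ β) {x : Edge 3 L → Fin 3 → ℝ} (hx : x ∈ cS L β) :
    Real.exp (-((min (1 / 40) (powScale (1 / 2) β * btLog β)) ^ 2 / powScale 1 β ^ 2 + (96 * (β / 2) + β) * (min (1 / 40) (powScale (1 / 2) β * btLog β)) ^ 2)) ≤ cΘ L β x := by
  obtain ⟨e, hr⟩ := cΘ_eq_on_cS (L := L) β hx
  set y := linkEmbed L x
  set r := min (1 / 40) (powScale (1 / 2) β * btLog β)
  have hy0 : 0 ≤ ‖y‖ := norm_nonneg _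
  have hP : ‖(gaugeModes L).starProjection y‖ ≤ ‖y‖ := Submodule.norm_starProjection_apply_le _ _
  have hP2 : ‖(gaugeModes L).starProjection y‖ ^ 2 ≤ r ^ 2 := by
    have := pow_le_pow_left₀ (norm_nonneg _) (hP.trans hr) 2; exact this
  have hq : stiffGaussExp L (β / 2) β y ≤ (96 * (β / 2) + β) * r ^ 2 :=
    (stiffGaussExp_le_mul_norm_sq (L := L) (by linarith) hβ y).trans (mul_le_mul_of_nonneg_left (pow_le_pow_left₀ hy0 hr 2) (by linarith))
  have hps : 0 < powScale 1 β ^ 2 := pow_pos (powScale_pos _ _) 2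
  rw [e, ← Real.exp_add]
  refine Real.exp_le_exp.2 ?_
  have h1 : ‖(gaugeModes L).starProjection y‖ ^ 2 / powScale 1 β ^ 2 ≤ r ^ 2 / powScale 1 β ^ 2 := div_le_div_of_nonneg_right hP2 hps.le
  linarith

end Summit.QuantumFields.YangMills.Theorems.FemtoTransferGap.TwoLattice.ConstTube

end
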